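import Literature.NumberTheory.LFunctions.WeilExplicitContinuous
import Literature.NumberTheory.LFunctions.WeilArchimedeanPositivityProofs
import HarnessLib

/-!
# The square mollifiers `ν_m = φ_m ⋆ φ̃_m`

Topic `Literature/NumberTheory/LFunctions`; complement to `WeilExplicitContinuous.lean` (same
normalisation: `ĝ(s) = weilMellin g s`, `g ⋆ h = weilConv g h`, `g̃ = weilReflect g`).  Everything here is
PROVED; no definitions (the mollifiers `φ_m = WeilContinuous.moll m` are the tree's), no named facts.

The Kreĭn–Bochner representation of the Weil functional (`WeilBochnerRepresentation.lean`) mollifies a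
window test `g` by the SQUARES `ν_m = φ_m ⋆ φ̃_m` of the normalised bumps `φ_m` rather than by `φ_m`
itself, because the transform of `ν_m` on the critical line is the nonnegative real `|φ̂_m(½+it)|²`
(`weilMellin_sqMoll_half`).  This file records that `(ν_m)` is an approximate identity in the sense of
`WeilExplicitApproxIdentity.lean`: `ν_m` is a Weil test (`isWeilTest_sqMoll`), a nonnegative real
(`sqMoll_apply`, `exists_sqMoll_eq_ofReal`), vanishes for `|x| ≥ 2/(m+1)` (`sqMoll_eq_zero`), and
`∫ ν_m = ∫ ‖ν_m‖ = 1` (`integral_sqMoll`, `integral_norm_sqMoll`). [cite: Bombieri2000Weil, §3]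
-/

noncomputable section

open Complex Filter Set MeasureTheory Topology
open scoped Real ComplexConjugate

namespace Literature.NumberTheory.LFunctions

namespace WeilSquareMollifier

open WeilContinuous

/-- `ν_m(x) = ∫ φ_m(v) φ_m(v - x) dv`, a real integral of a nonnegative integrand. [folklore] -/
theorem sqMoll_apply (m : ℕ) (x : ℝ) :
    weilConv (moll m) (weilReflect (moll m)) x =
      ((∫ v : ℝ, (bump m).normed volume v * (bump m).normed volume (v - x) : ℝ) : ℂ) := by
  rw [weilConv_apply, ← integral_complex_ofReal]
  congr 1 with v
  simp only [weilReflect, moll, neg_sub, Complex.conj_ofReal]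
  push_cast
  ring

/-- `ν_m(x)` is a nonnegative real. [folklore] -/
theorem exists_sqMoll_eq_ofReal (m : ℕ) (x : ℝ) :
    ∃ r : ℝ, 0 ≤ r ∧ weilConv (moll m) (weilReflect (moll m)) x = r :=
  ⟨_, integral_nonneg fun v => mul_nonneg ((bump m).nonneg_normed v) ((bump m).nonneg_normed _),
    sqMoll_apply m x⟩

/-- `‖ν_m(x)‖ = ν_m(x)` (as complex numbers). [folklore] -/
theorem ofReal_norm_sqMoll (m : ℕ) (x : ℝ) :
    ((‖weilConv (moll m) (weilReflect (moll m)) x‖ : ℝ) : ℂ) = weilConv (moll m) (weilReflect (moll m)) x := by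
  obtain ⟨r, hr, h⟩ := exists_sqMoll_eq_ofReal m x
  rw [h, Complex.norm_real, Real.norm_of_nonneg hr]

/-- `ν_m` is a Weil test. [folklore] -/
theorem isWeilTest_sqMoll (m : ℕ) : IsWeilTest (weilConv (moll m) (weilReflect (moll m))) :=
  (isWeilTest_moll m).weilConv (isWeilTest_moll m).weilReflect

/-- `ν_m` is continuous. [folklore] -/
theorem continuous_sqMoll (m : ℕ) : Continuous (weilConv (moll m) (weilReflect (moll m))) :=
  (isWeilTest_sqMoll m).1.continuous

/-- `tsupport φ_m ⊆ [-r_m, r_m]`, `r_m = 1/(m+1)`. [folklore] -/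
theorem tsupport_moll_subset (m : ℕ) : tsupport (moll m) ⊆ Icc (-(bump m).rOut) (bump m).rOut := by
  show tsupport (fun x : ℝ => (((bump m).normed volume x : ℝ) : ℂ)) ⊆ _
  refine (tsupport_comp_subset Complex.ofReal_zero _).trans ?_
  rw [(bump m).tsupport_normed_eq, Real.closedBall_eq_Icc, zero_sub, zero_add]

/-- `tsupport ν_m ⊆ [-2r_m, 2r_m]`. [folklore] -/
theorem tsupport_sqMoll_subset (m : ℕ) :
    tsupport (weilConv (moll m) (weilReflect (moll m))) ⊆ Icc (-(2 * (bump m).rOut)) (2 * (bump m).rOut) :=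
  tsupport_weilConv_weilReflect_subset (hasCompactSupport_moll m) (tsupport_moll_subset m)

/-- `ν_m(x) = 0` for `|x| ≥ 2 r_m` (the support of a continuous function is open). [folklore] -/
theorem sqMoll_eq_zero {m : ℕ} {x : ℝ} (hx : 2 * (bump m).rOut ≤ |x|) :
    weilConv (moll m) (weilReflect (moll m)) x = 0 := by
  have hsupp := support_subset_Ioo_of_tsupport_subset_Icc (continuous_sqMoll m) (tsupport_sqMoll_subset m)
  by_contra h
  have := hsupp (Function.mem_support.2 h)
  rw [mem_Ioo, ← abs_lt] at this
  linarith

/-- The radii `2 r_m = 2/(m+1)`. [folklore] -/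
theorem two_mul_bump_rOut (m : ℕ) : 2 * (bump m).rOut = 2 / ((m : ℝ) + 1) := by
  rw [bump_rOut]; ring

/-- **The transform of `ν_m` on the critical line is `|φ̂_m(½+it)|²`**, a nonnegative real.
[cite: Bombieri2000Weil, §3 eq. (3.2)] -/
theorem weilMellin_sqMoll_half (m : ℕ) (t : ℝ) :
    weilMellin (weilConv (moll m) (weilReflect (moll m))) (1 / 2 + t * I) =
      ((Complex.normSq (weilMellin (moll m) (1 / 2 + t * I)) : ℝ) : ℂ) :=
  weilMellin_weilQuadratic_of_re_eq (isWeilTest_moll m) (by simp)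

/-- … in particular it is a nonnegative real of modulus `≤ 1`. [folklore] -/
theorem exists_weilMellin_sqMoll_half_eq (m : ℕ) (t : ℝ) :
    ∃ r : ℝ, 0 ≤ r ∧ r ≤ 1 ∧ weilMellin (weilConv (moll m) (weilReflect (moll m))) (1 / 2 + t * I) = r := by
  refine ⟨_, Complex.normSq_nonneg _, ?_, weilMellin_sqMoll_half m t⟩
  rw [Complex.normSq_eq_norm_sq]
  have h := norm_weilMellin_moll_half_le m t
  nlinarith [norm_nonneg (weilMellin (moll m) (1 / 2 + t * I))]

/-- `∫ ν_m = 1` (`= ν̂_m(½) = |φ̂_m(½)|² = |∫ φ_m|²`). [folklore] -/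
theorem integral_sqMoll (m : ℕ) : ∫ x, weilConv (moll m) (weilReflect (moll m)) x = 1 := by
  have h1 : ∫ x, weilConv (moll m) (weilReflect (moll m)) x =
      weilMellin (weilConv (moll m) (weilReflect (moll m))) (1 / 2 + (0 : ℝ) * I) := by
    simp [weilMellin]
  have h2 : weilMellin (moll m) (1 / 2 + (0 : ℝ) * I) = 1 := by
    have := integral_moll m
    simp [weilMellin, this]
  rw [h1, weilMellin_sqMoll_half, h2]
  simp

/-- `∫ ‖ν_m‖ = 1`. [folklore] -/
theorem integral_norm_sqMoll (m : ℕ) : ∫ x, ‖weilConv (moll m) (weilReflect (moll m)) x‖ = 1 := by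
  have h : ((∫ x, ‖weilConv (moll m) (weilReflect (moll m)) x‖ : ℝ) : ℂ) = 1 := by
    rw [← integral_complex_ofReal]
    simp_rw [ofReal_norm_sqMoll]
    exact integral_sqMoll m
  exact_mod_cast h

/-- `2 r_m → 0`. [folklore] -/
theorem tendsto_two_mul_bump_rOut : Tendsto (fun m => 2 * (bump m).rOut) atTop (𝓝 0) := by
  simpa using tendsto_bump_rOut.const_mul 2

end WeilSquareMollifier

end Literature.NumberTheory.LFunctions

end
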